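import Mathlib.MeasureTheory.Integral.Lebesgue.Countable
import Mathlib.MeasureTheory.Integral.Bochner.Basic
import Mathlib.Topology.Algebra.InfiniteSum.ENNReal
import Literature.NumberTheory.LFunctions.WeilCriterionProofs
import Literature.NumberTheory.LFunctions.WeilArchimedeanPositivityProofs
import HarnessLib

/-!
# The zero-height measure and the Bochner representation of the Weil functional under RH

Topic `Literature/NumberTheory/LFunctions` (normalisation of `WeilExplicit.lean`: tests `IsWeilTest`,
transform `ĝ(s) = weilMellin g s`, functional `W = weilFunctional`, `Q(g) = W(g ⋆ g̃) = weilQuadratic g`;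
non-trivial zeros `ZetaZeros.riemannZetaNontrivialZeros` with multiplicity `riemannZetaZeroOrder`).

* `zetaZeroHeightMeasure` — the positive Borel measure `ν = Σ_ρ m(ρ)·δ_{Im ρ}` on `ℝ` (sum over the
  non-trivial zeros of `ζ`, each listed once and weighted by its multiplicity): the ordinates of the
  zeros, as a measure.  `lintegral_zetaZeroHeightMeasure`: `∫ f dν = Σ_ρ m(ρ) f(Im ρ)`.
* `weilQuadratic_eq_integral_of_riemannHypothesis` — **under RH, `Q(g) = W(g ⋆ g̃) = ∫ ‖ĝ(½+it)‖² dν(t)`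
  for EVERY test `g`**, with `‖ĝ(½+it)‖² ∈ L¹(ν)`: the Guinand–Weil explicit formula
  (`explicit_formula_holds`, absolutely convergent zero side `summable_norm_zeroSide`) with
  `(g ⋆ g̃)^(ρ) = ‖ĝ(ρ)‖²` on the critical line (Bombieri 2000 §3, eq. (3.2)), repackaged as an
  integral against `ν`.
* `riemannHypothesis_iff_exists_measure` — **RH ⟺ there is ONE positive measure `μ` on `ℝ` with
  `Re Q(g) = ∫ ‖ĝ(½+it)‖² dμ(t)` for all tests `g`** (`→`: `μ = ν`; `←`: `∫ ≥ 0` and Weil's criterion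
  `weil_criterion_holds`).  Compare the WINDOW version `WeilBochner.weilPositivityOn_iff_exists_measure`
  (`WeilBochnerRepresentation.lean`): `WeilPositivityOn b ⟺ ∃ μ_b` representing `Q` on tests
  supported in `[-b, b]`; so RH is the solvability of all the window moment problems at once
  (`riemannHypothesis_iff_forall_weilPositivityOn`), and then `ν` solves them coherently.

Everything here is PROVED; the only definition is the measure `ν`.  Not here: `ν[0, T] = N(T)`
(Riemann–von Mangoldt packaging), evenness of `ν`, or any unconditional relation between `ν` and the
window measures `μ_b`.

## References
* E. Bombieri, *Remarks on Weil's quadratic functional in the theory of prime numbers, I*,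
  Rend. Mat. Acc. Lincei (9) 11 (2000), Thm 1–2 and §3 eq. (3.2) [cite: Bombieri2000].
* A. Weil, *Sur les "formules explicites" de la théorie des nombres premiers* (1952) [cite: Weil1952].
-/

noncomputable section

open Complex Filter Set MeasureTheory
open scoped Real Topology ENNReal ComplexConjugate

namespace Literature.NumberTheory.LFunctions

namespace WeilBochner

open ZetaZeros ZetaZeros.riemannZetaNontrivialZeros

variable {g : ℝ → ℂ}

/-! ## The zero-height measure -/

/-- **The height measure of the non-trivial zeros of `ζ`**: `ν = Σ_ρ m(ρ)·δ_{Im ρ}`, a positive Borel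
measure on `ℝ` — the sum over the set `ZetaZeros.riemannZetaNontrivialZeros` (each zero listed once) of
the Dirac mass at the ordinate `Im ρ` weighted by the multiplicity `m(ρ) = riemannZetaZeroOrder ρ ≥ 1`
(as a natural number).  It is the zero side of the explicit formula (Bombieri 2000 Thm 2,
`Σ_ρ m(ρ) ĝ(ρ)`) seen on the critical line; under RH it is the spectral measure of Weil's form
(`weilQuadratic_eq_integral_of_riemannHypothesis`). [cite: Bombieri2000, Thm 2] -/
def zetaZeroHeightMeasure : Measure ℝ :=
  Measure.sum fun ρ : riemannZetaNontrivialZeros ↦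
    ((riemannZetaZeroOrder (ρ : ℂ)).toNat : ℝ≥0∞) • Measure.dirac (ρ : ℂ).im

/-- `∫ f dν = Σ_ρ m(ρ) f(Im ρ)` for measurable `f ≥ 0` (`lintegral` over a sum of weighted Dirac
masses). [cite: Bombieri2000, Thm 2] -/
theorem lintegral_zetaZeroHeightMeasure {f : ℝ → ℝ≥0∞} (hf : Measurable f) :
    ∫⁻ t, f t ∂zetaZeroHeightMeasure =
      ∑' ρ : riemannZetaNontrivialZeros,
        ((riemannZetaZeroOrder (ρ : ℂ)).toNat : ℝ≥0∞) * f (ρ : ℂ).im := by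
  rw [zetaZeroHeightMeasure, lintegral_sum_measure]
  refine tsum_congr fun ρ ↦ ?_
  rw [lintegral_smul_measure, lintegral_dirac' _ hf, smul_eq_mul]

/-- Under RH a non-trivial zero is `ρ = ½ + i·Im ρ` (Mathlib's `RiemannHypothesis`; the trivial zeros
and `s = 1` are excluded by `0 < Re ρ`, `ZetaZeros.riemannZetaNontrivialZeros.re_pos/ne_one`).
[folklore] -/
private theorem eq_half_add_im_of_riemannHypothesis (hRH : RiemannHypothesis) {ρ : ℂ}
    (hρ : ρ ∈ riemannZetaNontrivialZeros) : ρ = 1 / 2 + (ρ.im : ℂ) * I := by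
  have hre : ρ.re = 1 / 2 := by
    refine hRH ρ (zeta_eq_zero hρ) ?_ (ne_one hρ)
    rintro ⟨n, rfl⟩
    have h0 := re_pos hρ
    have e : (-2 * ((n : ℂ) + 1)) = ((-2 * ((n : ℝ) + 1) : ℝ) : ℂ) := by push_cast; ring
    rw [e, Complex.ofReal_re] at h0
    have : (0 : ℝ) ≤ n := n.cast_nonneg
    linarith
  apply Complex.ext
  · simp [hre]
  · simp

/-! ## `Q(g) = ∫ ‖ĝ(½+it)‖² dν` under RH -/

/-- **The Weil form as an integral against the zero-height measure, under RH.**  If the Riemann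
hypothesis holds then for every test `g` the spectral density `t ↦ ‖ĝ(½+it)‖²` is `ν`-integrable
(`ν = zetaZeroHeightMeasure`) and

  `W(g ⋆ g̃) = ∫ ‖ĝ(½ + it)‖² dν(t) = Σ_ρ m(ρ) ‖ĝ(ρ)‖²`.

Explicit formula `explicit_formula_holds` for `k = g ⋆ g̃` (zero side absolutely convergent,
`summable_norm_zeroSide`, hence equal to the `tsum`, `hasWeilZeroSide_tsum`), `k̂(ρ) = ‖ĝ(ρ)‖²` on the
line (`weilMellin_weilConv_weilReflect_half`), and `∫ dν = Σ_ρ m(ρ)·(·)(Im ρ)`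
(Bombieri 2000 §3, eq. (3.2)). [cite: Bombieri2000, §3 eq. (3.2)] -/
theorem weilQuadratic_eq_integral_of_riemannHypothesis (hRH : RiemannHypothesis) (hg : IsWeilTest g) :
    Integrable (fun t : ℝ ↦ ‖weilMellin g (1 / 2 + t * I)‖ ^ 2) zetaZeroHeightMeasure ∧
      weilQuadratic g =
        ((∫ t, ‖weilMellin g (1 / 2 + t * I)‖ ^ 2 ∂zetaZeroHeightMeasure : ℝ) : ℂ) := by
  set F : ℝ → ℝ := fun t ↦ ‖weilMellin g (1 / 2 + t * I)‖ ^ 2 with hF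
  have hFc : Continuous F := by
    have h1 : Continuous fun t : ℝ ↦ (1 / 2 : ℂ) + t * I := by fun_prop
    exact ((continuous_weilMellin hg.1.continuous hg.2).comp h1).norm.pow 2
  have hF0 : ∀ t, 0 ≤ F t := fun t ↦ by positivity
  -- the square and its zero side
  set k := weilConv g (weilReflect g) with hk_def
  have hk : IsWeilTest k := hg.weilConv hg.weilReflect
  have hsum := summable_norm_zeroSide hk
  have hWZ : weilFunctional k =
      ∑' ρ : riemannZetaNontrivialZeros, (riemannZetaZeroOrder (ρ : ℂ) : ℂ) * weilMellin k ρ :=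
    tendsto_nhds_unique (explicit_formula_holds hk) (hasWeilZeroSide_tsum hsum)
  -- termwise: `m(ρ) k̂(ρ) = m(ρ) ‖ĝ(½ + i Im ρ)‖²`
  set m : riemannZetaNontrivialZeros → ℕ := fun ρ ↦ (riemannZetaZeroOrder (ρ : ℂ)).toNat with hm
  have hmC : ∀ ρ : riemannZetaNontrivialZeros, ((m ρ : ℕ) : ℂ) = (riemannZetaZeroOrder (ρ : ℂ) : ℂ) :=
    fun ρ ↦ by
      have h1 : ((m ρ : ℕ) : ℤ) = riemannZetaZeroOrder (ρ : ℂ) :=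
        Int.toNat_of_nonneg (by linarith [one_le_order ρ.2])
      rw [← Int.cast_natCast, h1]
  have hterm : ∀ ρ : riemannZetaNontrivialZeros,
      (riemannZetaZeroOrder (ρ : ℂ) : ℂ) * weilMellin k ρ = (((m ρ : ℝ) * F (ρ : ℂ).im : ℝ) : ℂ) := by
    intro ρ
    have e := congrArg (weilMellin k) (eq_half_add_im_of_riemannHypothesis hRH ρ.2)
    rw [e, hk_def, weilMellin_weilConv_weilReflect_half hg, ← hmC]
    simp only [hF]
    push_cast
    ring
  have hterm0 : ∀ ρ : riemannZetaNontrivialZeros, 0 ≤ (m ρ : ℝ) * F (ρ : ℂ).im := fun ρ ↦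
    mul_nonneg (Nat.cast_nonneg _) (hF0 _)
  have hsumR : Summable fun ρ : riemannZetaNontrivialZeros ↦ (m ρ : ℝ) * F (ρ : ℂ).im :=
    hsum.congr fun ρ ↦ by
      rw [hterm, Complex.norm_real, Real.norm_eq_abs, abs_of_nonneg (hterm0 ρ)]
  set S : ℝ := ∑' ρ : riemannZetaNontrivialZeros, (m ρ : ℝ) * F (ρ : ℂ).im with hS
  have hS0 : 0 ≤ S := tsum_nonneg hterm0
  have hWS : weilFunctional k = (S : ℂ) := by
    rw [hWZ, hS, Complex.ofReal_tsum]
    exact tsum_congr hterm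
  -- the integral against `ν`
  have hlint : ∫⁻ t, ENNReal.ofReal (F t) ∂zetaZeroHeightMeasure = ENNReal.ofReal S := by
    rw [lintegral_zetaZeroHeightMeasure hFc.measurable.ennreal_ofReal, hS,
      ENNReal.ofReal_tsum_of_nonneg hterm0 hsumR]
    refine tsum_congr fun ρ ↦ ?_
    rw [ENNReal.ofReal_mul (Nat.cast_nonneg _), ENNReal.ofReal_natCast]
  have hint : Integrable F zetaZeroHeightMeasure :=
    ⟨hFc.aestronglyMeasurable,
      (hasFiniteIntegral_iff_ofReal (ae_of_all _ hF0)).2 (by rw [hlint]; exact ENNReal.ofReal_lt_top)⟩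
  have hI : ∫ t, F t ∂zetaZeroHeightMeasure = S := by
    rw [integral_eq_lintegral_of_nonneg_ae (ae_of_all _ hF0) hFc.aestronglyMeasurable, hlint,
      ENNReal.toReal_ofReal hS0]
  refine ⟨hint, ?_⟩
  show weilFunctional (weilConv g (weilReflect g)) = _
  rw [← hk_def, hWS, hI]

/-- Under RH there is one positive measure on `ℝ` representing Weil's form on ALL tests:
`∃ μ, ∀ g test, ‖ĝ(½+it)‖² ∈ L¹(μ) ∧ W(g ⋆ g̃) = ∫ ‖ĝ(½+it)‖² dμ` (namely
`μ = zetaZeroHeightMeasure`). [cite: Bombieri2000, §3 eq. (3.2)] -/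
theorem exists_measure_of_riemannHypothesis (hRH : RiemannHypothesis) :
    ∃ μ : Measure ℝ, ∀ g : ℝ → ℂ, IsWeilTest g →
      Integrable (fun t : ℝ ↦ ‖weilMellin g (1 / 2 + t * I)‖ ^ 2) μ ∧
        weilQuadratic g = ((∫ t, ‖weilMellin g (1 / 2 + t * I)‖ ^ 2 ∂μ : ℝ) : ℂ) :=
  ⟨zetaZeroHeightMeasure, fun _ hg ↦ weilQuadratic_eq_integral_of_riemannHypothesis hRH hg⟩

/-- **RH ⟺ Weil's quadratic form is represented by a positive measure on the critical line**:
`RiemannHypothesis ↔ ∃ μ (measure on ℝ), ∀ g test, Re W(g ⋆ g̃) = ∫ ‖ĝ(½+it)‖² dμ(t)`.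
(`→`: the zero-height measure, `weilQuadratic_eq_integral_of_riemannHypothesis`; `←`: the integral of
a nonnegative function is `≥ 0`, so `WeilPositivity` holds, and Weil's criterion
`weil_criterion_holds` gives RH.)  Bochner–Schwartz form of Weil's criterion (Weil 1952; Bombieri 2000
Thm 1). [cite: Bombieri2000, Thm 1] -/
theorem riemannHypothesis_iff_exists_measure :
    RiemannHypothesis ↔ ∃ μ : Measure ℝ, ∀ g : ℝ → ℂ, IsWeilTest g →
      (weilQuadratic g).re = ∫ t, ‖weilMellin g (1 / 2 + t * I)‖ ^ 2 ∂μ := by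
  constructor
  · intro hRH
    refine ⟨zetaZeroHeightMeasure, fun g hg ↦ ?_⟩
    rw [(weilQuadratic_eq_integral_of_riemannHypothesis hRH hg).2, Complex.ofReal_re]
  · rintro ⟨μ, hμ⟩
    refine weil_criterion_holds.2 fun g hg ↦ ?_
    rw [hμ g hg]
    exact integral_nonneg fun t ↦ by positivity

end WeilBochner

end Literature.NumberTheory.LFunctions

end
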